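import Summits.CriticalPhenomena.PercolationContinuityZ3.Theorems.PercNearOneGluingNoHeavyLowerTailSahiSunflowerAllOrders
import Literature.Combinatorics.Sahi2008.Percolation
import Literature.Combinatorics.Sahi2008.PushForward
import HarnessLib

/-!
# `NoHeavyLowerTail` (crux stmt-CriticalPhenomena-4575), master-family line P2: the open increasing E3GRP class `γ` IS the
# whole Sahi hierarchy of its event algebra

Support file (seat `prim-masterthm-p2`, `--supports stmt-CriticalPhenomena-4575 --as helper`); no named fact, no sorry, nothing
open is claimed.  Companion of `…SahiSunflowerAllOrders.lean` (`M3.sahiPositive_m3_iff`).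

The class `γ` (prim-ineq-gen-8 g4; lit-4 g10): four vertices `a b c y` of a finite weighted graph and the three increasing
group connections `L₁ = lnk[ab|cy]`, `L₂ = lnk[ac|by]`, `L₃ = lnk[ay|bc]` (written out as unions of `openConn`).  Their
complements, the `2|2` separations, form a Δ-system (any two of them force all six pairwise separations — `sunflower₁₂/₁₃/₂₃`,
pure bookkeeping), so the pattern map `patGamma` onto the five-point poset `M₃` (`core` = all four vertices mutually separated,
`pet i` = exactly the `i`-th `2|2` separation, `out` = no `2|2` separation; MONOTONE in the configuration) pulls the up-sets
`D 0, D 1, D 2` back to `L₁, L₂, L₃` (`setInd_D_comp_patGamma`), and the cubic of the pushed weight is the row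
`γ = E₃(L₁, L₂, L₃)` (`patGamma_cubic_eq`).
* `sahiPositive_patGamma_iff` — `(∀ n, SahiPositive (γ-pattern weight) n) ↔ 0 ≤ E₃(L₁, L₂, L₃)`: the single open cubic row
  `γ` (kernel theorem for `≤ 5` vertices only, `E3GroupSepLeFive`; OPEN for all graphs) is equivalent to Sahi positivity of
  EVERY order on its algebra — there is nothing weaker to prove first and nothing further to prove after.
-/

noncomputable section

namespace Summit.CriticalPhenomena.PercolationContinuityZ3.Theorems.SahiDeltaSystem

open Finset Function MeasureTheory Literature.Combinatorics.Sahi2008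
open Literature.Probability.LatticeModels (prodBernoulli sahiE3)
open Literature.Probability.Percolation
open Literature.Probability.Percolation.DecisionTree (ind ind_of_mem ind_of_not_mem ind_nonneg)
open M3

variable {V : Type*} [Fintype V]

/-- The `γ`-pattern map of four vertices: `core` = no `2|2` group connection at all (all six pairs separated), `pet 0/1/2` =
exactly `lnk[ab|cy] / lnk[ac|by] / lnk[ay|bc]` fails, `out` = all three group connections hold. [this work] -/
def patGamma (a b c y : V) (ω : BondConfig V) : M3 := by
  classical
  exact
    if ω ∉ openConn a c ∪ openConn a y ∪ openConn b c ∪ openConn b y ∧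
        ω ∉ openConn a b ∪ openConn a y ∪ openConn b c ∪ openConn c y then core
    else if ω ∉ openConn a c ∪ openConn a y ∪ openConn b c ∪ openConn b y then pet 0
    else if ω ∉ openConn a b ∪ openConn a y ∪ openConn b c ∪ openConn c y then pet 1
    else if ω ∉ openConn a b ∪ openConn a c ∪ openConn b y ∪ openConn c y then pet 2 else out

omit [Fintype V] in
/-- The up-sets `D i` of `M₃` pull back along `patGamma` to the three group connections `lnk[ab|cy], lnk[ac|by], lnk[ay|bc]`
(uses only that two `2|2` separations force the third). [this work] -/
theorem setInd_D_comp_patGamma (a b c y : V) :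
    (setInd (D 0) ∘ patGamma a b c y = ind (openConn a c ∪ openConn a y ∪ openConn b c ∪ openConn b y)) ∧
      (setInd (D 1) ∘ patGamma a b c y = ind (openConn a b ∪ openConn a y ∪ openConn b c ∪ openConn c y)) ∧
        (setInd (D 2) ∘ patGamma a b c y = ind (openConn a b ∪ openConn a c ∪ openConn b y ∪ openConn c y)) := by
  refine ⟨?_, ?_, ?_⟩ <;> funext ω <;>
    simp only [Function.comp, setInd_apply, D, Finset.mem_erase, Finset.mem_univ, patGamma, ind, Set.mem_union] <;>
    by_cases h1 : ω ∈ openConn a c ∪ openConn a y ∪ openConn b c ∪ openConn b y <;>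
    by_cases h2 : ω ∈ openConn a b ∪ openConn a y ∪ openConn b c ∪ openConn c y <;>
    by_cases h3 : ω ∈ openConn a b ∪ openConn a c ∪ openConn b y ∪ openConn c y <;>
    simp only [Set.mem_union] at h1 h2 h3 <;>
    simp (config := { decide := true }) [h1, h2, h3] <;> tauto

/-- **The cubic of the `γ`-pattern weight is the row `γ`.** [this work] -/
theorem patGamma_cubic_eq (w : Sym2 V → unitInterval) (a b c y : V) :
    sahiE (pushWeight (bernoulliWeight w) (patGamma a b c y)) 3 ![setInd (D 0), setInd (D 1), setInd (D 2)] =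
      sahiE3 (prodBernoulli w) (openConn a c ∪ openConn a y ∪ openConn b c ∪ openConn b y)
        (openConn a b ∪ openConn a y ∪ openConn b c ∪ openConn c y)
        (openConn a b ∪ openConn a c ∪ openConn b y ∪ openConn c y) := by
  rw [sahiE_pushWeight]
  obtain ⟨h0, h1, h2⟩ := setInd_D_comp_patGamma (V := V) a b c y
  have e : (fun i => (![setInd (D 0), setInd (D 1), setInd (D 2)] : Fin 3 → M3 → ℝ) i ∘ patGamma a b c y) =
      ![ind (openConn a c ∪ openConn a y ∪ openConn b c ∪ openConn b y),
        ind (openConn a b ∪ openConn a y ∪ openConn b c ∪ openConn c y),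
        ind (openConn a b ∪ openConn a c ∪ openConn b y ∪ openConn c y)] := by
    funext i
    fin_cases i
    · exact h0
    · exact h1
    · exact h2
  rw [e, sahiE_three_ind]

/-- **`γ` is the whole hierarchy of its algebra.**  For every finite weighted graph and vertices `a b c y`: the `γ`-pattern
weight is Sahi-positive of EVERY order iff the single cubic row `γ = E₃(lnk[ab|cy], lnk[ac|by], lnk[ay|bc]) ≥ 0` holds (the row is
OPEN in general; nothing about it is claimed here). [this work] -/
theorem sahiPositive_patGamma_iff (w : Sym2 V → unitInterval) (a b c y : V) :
    (∀ n, SahiPositive (pushWeight (bernoulliWeight w) (patGamma a b c y)) n) ↔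
      0 ≤ sahiE3 (prodBernoulli w) (openConn a c ∪ openConn a y ∪ openConn b c ∪ openConn b y)
        (openConn a b ∪ openConn a y ∪ openConn b c ∪ openConn c y)
        (openConn a b ∪ openConn a c ∪ openConn b y ∪ openConn c y) := by
  have hν0 : ∀ x, 0 ≤ pushWeight (bernoulliWeight w) (patGamma a b c y) x :=
    fun x => pushWeight_nonneg (isFKGMeasure_bernoulliWeight w).nonneg _ x
  have hν1 : ∑ x, pushWeight (bernoulliWeight w) (patGamma a b c y) x = 1 := by
    rw [sum_pushWeight, sum_bernoulliWeight]
  rw [sahiPositive_m3_iff hν0 hν1, ← sahiE_three_D hν1, patGamma_cubic_eq]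

/-- One direction spelled out: a proof of the row `γ` on a graph yields `E_n ≥ 0` for EVERY `n` and all nonnegative
`γ`-pattern-measurable functions increasing in the configuration. [this work] -/
theorem sahiE_gammaPattern_nonneg_of_row (w : Sym2 V → unitInterval) (a b c y : V)
    (hγ : 0 ≤ sahiE3 (prodBernoulli w) (openConn a c ∪ openConn a y ∪ openConn b c ∪ openConn b y)
        (openConn a b ∪ openConn a y ∪ openConn b c ∪ openConn c y)
        (openConn a b ∪ openConn a c ∪ openConn b y ∪ openConn c y))
    {n : ℕ} (f : Fin n → M3 → ℝ) (hf0 : ∀ i x, 0 ≤ f i x) (hmono : ∀ i, Monotone (f i)) :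
    0 ≤ sahiE (bernoulliWeight w) n fun i => f i ∘ patGamma a b c y := by
  rw [← sahiE_pushWeight]
  exact (sahiPositive_patGamma_iff w a b c y).2 hγ n f hf0 hmono

end Summit.CriticalPhenomena.PercolationContinuityZ3.Theorems.SahiDeltaSystem
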